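import Summits.QuantumFields.YangMills.Theses.SlackWindow
import Summits.QuantumFields.YangMills.Theses.TypicalExteriorCeilings

/-!
# SlackWindow — the canonical (σ = 0) ceilings currency implies `SlackCeilings`

BC5-type rung / wuc certificate for route `SlackWindow` (critic #47 P3): the ceilings hypothesis of
`TypicalExteriorCeilings.FactorialCalibration` (canonical collar decay `(C n^κ / R⁴)ⁿ` on every
sub-onset collar) implies `SlackWindow.SlackCeilings` by taking the slack exponent `σ := 0`
(`((R·s)⁻¹)^0 = 1`).  Pure logic + `pow_zero`; no analysis.
-/

namespace Summit.QuantumFields.YangMills.Theorems.SlackWindowOfCanonical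

/-- The σ = 0 (canonical) ceilings currency — verbatim the antecedent of
`TypicalExteriorCeilings.FactorialCalibration` — implies `SlackWindow.SlackCeilings`. -/
theorem slackCeilings_of_canonical
    (hcan : open Literature.MathematicalPhysics.QuantumFieldTheory Literature.MathematicalPhysics.QuantumLattice Summit.QuantumFields.YangMills.Cruxes.OSLegsFromFemtoAndGap.DlrCollarTransfer in ∀ (G : Type) [Group G] [TopologicalSpace G] [IsTopologicalGroup G] [CompactSpace G], IsCompactSimpleLieGroup G → Nonempty (G ≃ₜ* Matrix.specialUnitaryGroup (Fin 2) ℂ) → letI : MeasurableSpace G := borel G; haveI : BorelSpace G := ⟨rfl⟩; ∀ (r : LatticeRep G) (v f g h : SchwartzMap (EuclideanSpace ℝ (Fin 4)) ℝ) (Λ₅ : ℝ), ∃ ε₀ : ℝ, 0 < ε₀ ∧ ∀ ε : ℝ, 0 < ε → ε ≤ ε₀ → (∃ β₅ : ℝ, ∀ β : ℝ, β₅ ≤ β → ∃ s : ℝ, 0 < s ∧ s ≤ 1 ∧ (∀ L : ℕ, Λ₅ ≤ s * L → ε ≤ Q2 G r β L s (thetaTest 4 v) v) ∧ (∀ L :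 ℕ, Λ₅ ≤ s * L → ε ≤ |Q3 G r β L s f g h|)) → ∃ (C κ ℓ₄ β₄ : ℝ), 0 < ℓ₄ ∧ 0 ≤ C ∧ 0 ≤ κ ∧ ∀ β : ℝ, β₄ ≤ β → ∀ s : ℝ, 0 < s → s ≤ 1 → (∀ s' : ℝ, 2 * s ≤ s' → s' ≤ 1 → ¬ ((∀ L : ℕ, Λ₅ ≤ s' * L → ε ≤ Q2 G r β L s' (thetaTest 4 v) v) ∧ (∀ L : ℕ, Λ₅ ≤ s' * L → ε ≤ |Q3 G r β L s' f g h|))) → ∀ (L n : ℕ) (q : Fin n → Fin 4 × Fin 4) (x : Fin n → (Fin 4 → ℤ)) (R : ℕ), (∀ i, (q i).1 < (q i).2) → 1 ≤ R → (R : ℝ) * s ≤ ℓ₄ → 4 * R + 8 ≤ L → (∀ i j : Fin n, i ≠ j → ∃ k : Fin 4, (2 * (R : ℤ) + 4) ≤ |((((x i k - x j k : ℤ) : ZMod (2 * L + 1))).valMinAbs : ℤ)|) → |torusE G r β L (fun U => ∏ i, (plane G r (q i) (x i) U - torusE G r β L (plane G r (q i) (x i))))| ≤ (C * (n : ℝ)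 ^ κ / (R : ℝ) ^ 4) ^ n) :
    Summit.QuantumFields.YangMills.Theses.SlackWindow.SlackCeilings := by
  intro G _ _ _ _ hG hSU r v f g h Λ₅
  obtain ⟨ε₀, hε₀, hmain⟩ := hcan G hG hSU r v f g h Λ₅
  refine ⟨ε₀, hε₀, fun ε hε hεle hfl => ?_⟩
  obtain ⟨C, κ, ℓ₄, β₄, hℓ₄, hC, hκ, hrest⟩ := hmain ε hε hεle hfl
  refine ⟨0, C, κ, ℓ₄, β₄, hℓ₄, hC, hκ, ?_⟩
  intro β hβ s hs hs1 hno L n q x R hq hR hRs hRL hsep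
  simpa only [pow_zero, mul_one] using hrest β hβ s hs hs1 hno L n q x R hq hR hRs hRL hsep

end Summit.QuantumFields.YangMills.Theorems.SlackWindowOfCanonical
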